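import Summits.BirchSwinnertonDyer.Rank1Residual.X12.O11.RouteUPrimeMember
import Summits.BirchSwinnertonDyer.Rank1Residual.X12.O11.RouteUBernoulliD11
import HarnessLib

/-!
# ROUTE U, prime member `D = −43` (curve `90601c1`, `N = 49·43² = 90601`), Heegner field
# `K'' = ℚ(√−19)`: the two Bernoulli-unit certificates, BSD₇ and FULL BSD by the prime-member class theorem

bsd-cm cell (run/shared/lean/pub/bsd-cm/), ROUTE U, seat `bsd-cm-ram`. Instance of
`RouteU.bsdp_seven_of_twist_cm7_prime` at `(q, r) = (43, 19)`: `43 ≡ 19 ≡ 3 (mod 4)`,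
`(−19/7) = (−19/43) = 1`. The per-member inputs are the two kernel certificates (`decide +kernel`,
mod-`49` sums of lengths `301` and `5719`, the second in 4 blocks of ≤ 1500 terms):
* `norm_generalizedBernoulli_theta1_D43` — `‖B_{1,ω⁴χ_{−43}}‖₇ = 1` (`S₁ = Σ_{j<301} (j/43)·j²⁹`, `7 ∥ S₁`);
* `norm_generalizedBernoulli_theta2_D43` — `‖B_{1,ωχ_{−43}χ_{−19}}‖₇ = 1` (`S₂ = Σ_{j<5719} (j/43)(j/19)·j⁸`, `7 ∥ S₂`);
* **`bsdp_seven_of_twist_cm7_D43`** — BSD₇ for every globally minimal model of `49a1^{(−43)}` with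
  `r_an = 1`, from the class theorem (named facts: Kriz–Li Thm 1.20 / Rem 3.10, Gross–Zagier, Kolyvagin,
  GZK, modularity, Rubin 1983 Thm C, Burungale–Flach 2024, Buhler–Gross 1985 Ch. II; displayed data:
  Heegner datum over `ℚ(√−19)`, a Mordell–Weil coordinate over `K`, `L(W^{(−19)},1) ≠ 0`, the twin's
  minimal model, `7 ∤ c` (Manin constant)); the descent inputs (no `7`-torsion over `K`, `7 ∤ #Ш(W)`)
  are discharged inside the class theorem;
* `forall_bsdp_of_twist_cm7_D43` — FULL BSD (Miller's `BSD(E,p)` at every prime), `W ∈ 𝒞₇` since `(−7/43) = 1`.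
THEOREMS ONLY; nothing booked. References: [KrizLi2019] Thm. 1.20; [Washington1997] §5.1, Thm 4.2;
[Rubin1983] Thm C; [BuhlerGross1985] Ch. II; [BurungaleFlach2024] Thm 1.1; [Miller2011LMS] Def. 1.1.
-/

noncomputable section

open scoped Classical
open NumberField WeierstrassCurve DirichletCharacter
open Literature.NumberTheory.EllipticCurves Literature.NumberTheory.EllipticCurves.Rank1Residual
open Literature.NumberTheory.EllipticCurves.KrizLi2019 Literature.NumberTheory.LFunctions
open Literature.NumberTheory.EllipticCurves.ModularForms

namespace Summit.BirchSwinnertonDyer.Rank1Residual.X12.O11.RouteU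

/-- `43` is prime (a `Prop`-instance registered as a theorem). [folklore] -/
@[instance] theorem fact_prime_43_D43 : Fact (Nat.Prime 43) := ⟨by norm_num⟩

/-- `ord₇ (7·43) = 1`. [folklore] -/
theorem padicValNat_seven_level1_D43 : padicValNat 7 (7 * 43) = 1 := by
  rw [padicValNat.mul (by norm_num) (by norm_num), padicValNat_self, padicValNat.eq_zero_of_not_dvd (by norm_num)]

/-- `ord₇ (7·43·19) = 1`. [folklore] -/
theorem padicValNat_seven_level2_D43 : padicValNat 7 (7 * 43 * 19) = 1 := by
  rw [show (7 * 43 * 19 : ℕ) = 7 * (43 * 19) by ring, padicValNat.mul (by norm_num) (by norm_num),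
    padicValNat_self, padicValNat.eq_zero_of_not_dvd (by norm_num)]

set_option maxRecDepth 400000 in
/-- **`‖B_{1,θ₁}‖₇ = 1`** for every character `θ₁` mod `7·43` with values `(j/43)·ω(j)⁴`, `ω`
Teichmüller (certificate `7 ∥ Σ_{j<301} (j/43) j²⁹`, `decide +kernel`).
[cite: KrizLi2019, Thm. 1.20 (p. 8) and §1.5 (1)] [cite: Washington1997, §5.1 and Thm. 4.2] -/
theorem norm_generalizedBernoulli_theta1_D43 (ω : DirichletCharacter ℚ_[7] 7)
    (hω : IsTeichmullerCharacter ω) (θ : DirichletCharacter ℚ_[7] (7 * 43))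
    (hθ : ∀ j : ZMod (7 * 43), θ j = (legendreSym 43 (j.val : ℤ) : ℚ_[7]) * ω (j.val : ZMod 7) ^ 4) :
    ‖generalizedBernoulli 1 θ‖ = 1 := by
  have hθ1 : θ ≠ 1 := by
    intro h1
    have hv := hθ (((300 : ℕ)) : ZMod (7 * 43))
    have hval : (((300 : ℕ) : ZMod (7 * 43))).val = 300 := by
      rw [ZMod.val_natCast]
    have h6 : (((300 : ℕ)) : ZMod 7) = ((6 : ℕ) : ZMod 7) := by decide
    have hu : IsUnit (((300 : ℕ)) : ZMod (7 * 43)) := by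
      rw [ZMod.isUnit_iff_coprime]; norm_num
    rw [h1, hval, MulChar.one_apply hu, h6, apply_neg_one_pow_four, mul_one] at hv
    have hL : legendreSym 43 ((300 : ℕ) : ℤ) = -1 := by
      rw [legendreSym_eq_ite 43 (by norm_num)]; decide
    rw [hL] at hv
    norm_num at hv
  refine norm_generalizedBernoulli_one_eq_one_of_cert θ hθ1 padicValNat_seven_level1_D43
    (fun j => legendreSym 43 (j.val : ℤ)) 28 (fun j => ?_) ?_ ?_
  · have := norm_sub_le_of_values ω hω θ (fun m => legendreSym 43 (m : ℤ)) 4 (by norm_num) hθ j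
    simpa using this
  · simp_rw [legendreSym_eq_ite 43 (by norm_num)]
    decide +kernel
  · simp_rw [legendreSym_eq_ite 43 (by norm_num)]
    decide +kernel

set_option maxRecDepth 400000 in
/-- Block 0 of the `θ₂` certificate for `D = −43`: `Σ_{0 ≤ j < 1500} (j/43)(j/19) j⁸` evaluated (`decide +kernel`). [folklore] -/
theorem theta2_D43_block0 :
    ∑ j ∈ Finset.Ico (0 : ℕ) 1500, (legendreSym 43 (j : ℤ) * legendreSym 19 (j : ℤ)) * (j : ℤ) ^ (7 + 1) =
      -108244642746554537678754975 := by
  simp_rw [legendreSym_eq_ite 43 (by norm_num), legendreSym_eq_ite 19 (by norm_num)]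
  decide +kernel

set_option maxRecDepth 400000 in
/-- Block 1 of the `θ₂` certificate for `D = −43`: `Σ_{1500 ≤ j < 3000} (j/43)(j/19) j⁸` evaluated (`decide +kernel`). [folklore] -/
theorem theta2_D43_block1 :
    ∑ j ∈ Finset.Ico (1500 : ℕ) 3000, (legendreSym 43 (j : ℤ) * legendreSym 19 (j : ℤ)) * (j : ℤ) ^ (7 + 1) =
      -30293954654925321091557119613 := by
  simp_rw [legendreSym_eq_ite 43 (by norm_num), legendreSym_eq_ite 19 (by norm_num)]
  decide +kernel

set_option maxRecDepth 400000 in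
/-- Block 2 of the `θ₂` certificate for `D = −43`: `Σ_{3000 ≤ j < 4500} (j/43)(j/19) j⁸` evaluated (`decide +kernel`). [folklore] -/
theorem theta2_D43_block2 :
    ∑ j ∈ Finset.Ico (3000 : ℕ) 4500, (legendreSym 43 (j : ℤ) * legendreSym 19 (j : ℤ)) * (j : ℤ) ^ (7 + 1) =
      126862341753637903985767847971 := by
  simp_rw [legendreSym_eq_ite 43 (by norm_num), legendreSym_eq_ite 19 (by norm_num)]
  decide +kernel

set_option maxRecDepth 400000 in
/-- Block 3 of the `θ₂` certificate for `D = −43`: `Σ_{4500 ≤ j < 5719} (j/43)(j/19) j⁸` evaluated (`decide +kernel`). [folklore] -/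
theorem theta2_D43_block3 :
    ∑ j ∈ Finset.Ico (4500 : ℕ) (7 * 43 * 19), (legendreSym 43 (j : ℤ) * legendreSym 19 (j : ℤ)) * (j : ℤ) ^ (7 + 1) =
      2555358583771585456966761645241 := by
  simp_rw [legendreSym_eq_ite 43 (by norm_num), legendreSym_eq_ite 19 (by norm_num)]
  decide +kernel

/-- The `θ₂` certificate sum for `D = −43` assembled from its blocks: `Σ_{j<5719} (j/43)(j/19) j⁸ = S₂` with `7 ∥ S₂`. [folklore] -/
theorem theta2_D43_sum :
    ∑ j ∈ Finset.range (7 * 43 * 19), (legendreSym 43 (j : ℤ) * legendreSym 19 (j : ℤ)) * (j : ℤ) ^ (7 + 1) =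
      2651818726227551485323293618624 := by
  rw [Finset.range_eq_Ico, ← Finset.sum_Ico_consecutive _ (show 0 ≤ 1500 by norm_num) (show 1500 ≤ 7 * 43 * 19 by norm_num), ← Finset.sum_Ico_consecutive _ (show 1500 ≤ 3000 by norm_num) (show 3000 ≤ 7 * 43 * 19 by norm_num), ← Finset.sum_Ico_consecutive _ (show 3000 ≤ 4500 by norm_num) (show 4500 ≤ 7 * 43 * 19 by norm_num), theta2_D43_block0, theta2_D43_block1, theta2_D43_block2, theta2_D43_block3]
  norm_num

set_option maxRecDepth 400000 in
/-- **`‖B_{1,θ₂}‖₇ = 1`** for every character `θ₂` mod `7·43·19` with values `(j/43)·J(j | 19)·ω(j)`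
(certificate `7 ∥ Σ_{j<5719} (j/43)(j/19) j⁸`, `decide +kernel`).
[cite: KrizLi2019, Thm. 1.20 (p. 8) and §1.5 (1)] [cite: Washington1997, §5.1 and Thm. 4.2] -/
theorem norm_generalizedBernoulli_theta2_D43 (ω : DirichletCharacter ℚ_[7] 7)
    (hω : IsTeichmullerCharacter ω) (θ : DirichletCharacter ℚ_[7] (7 * 43 * 19))
    (hθ : ∀ j : ZMod (7 * 43 * 19), θ j =
      ((legendreSym 43 (j.val : ℤ) * jacobiSym (j.val : ℤ) 19 : ℤ) : ℚ_[7]) * ω (j.val : ZMod 7) ^ 1) :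
    ‖generalizedBernoulli 1 θ‖ = 1 := by
  have hθ' : ∀ j : ZMod (7 * 43 * 19), θ j =
      ((legendreSym 43 (j.val : ℤ) * legendreSym 19 (j.val : ℤ) : ℤ) : ℚ_[7]) * ω (j.val : ZMod 7) ^ 1 :=
    fun j => by rw [hθ j, ← jacobiSym.legendreSym.to_jacobiSym]
  have hθ1 : θ ≠ 1 := by
    intro h1
    have hv := hθ' (((5718 : ℕ)) : ZMod (7 * 43 * 19))
    have hval : (((5718 : ℕ) : ZMod (7 * 43 * 19))).val = 5718 := by
      rw [ZMod.val_natCast]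
    have hu : IsUnit (((5718 : ℕ)) : ZMod (7 * 43 * 19)) := by
      rw [ZMod.isUnit_iff_coprime]; norm_num
    rw [h1, hval, MulChar.one_apply hu, pow_one] at hv
    have hL : legendreSym 43 ((5718 : ℕ) : ℤ) * legendreSym 19 ((5718 : ℕ) : ℤ) = 1 := by
      rw [legendreSym_eq_ite 43 (by norm_num), legendreSym_eq_ite 19 (by norm_num)]; decide
    rw [hL, Int.cast_one, one_mul] at hv
    -- `ω(−1) = 1` contradicts `‖ω(6) − 6‖ < 1`
    have h6 : (((5718 : ℕ)) : ZMod 7) = ((6 : ℤ) : ZMod 7) := by decide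
    rw [h6] at hv
    have hT := hω 6 (by decide)
    rw [← hv] at hT
    have : ‖(1 : ℚ_[7]) - ((6 : ℤ) : ℚ_[7])‖ = 1 := by
      rw [show (1 : ℚ_[7]) - ((6 : ℤ) : ℚ_[7]) = -((5 : ℕ) : ℚ_[7]) by norm_num, norm_neg]
      exact Padic.norm_natCast_eq_one_iff.mpr (by decide)
    rw [this] at hT
    exact lt_irrefl _ hT
  refine norm_generalizedBernoulli_one_eq_one_of_cert_range θ hθ1 padicValNat_seven_level2_D43
    (fun j => legendreSym 43 (j : ℤ) * legendreSym 19 (j : ℤ)) 7 (fun j => ?_) 2651818726227551485323293618624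
    theta2_D43_sum (by norm_num) (by norm_num)
  have := norm_sub_le_of_values ω hω θ (fun m => legendreSym 43 (m : ℤ) * legendreSym 19 (m : ℤ))
    1 le_rfl hθ' j
  simpa using this

/-- **ROUTE U, member `D = −43` (`90601c1`, `N = 49·43² = 90601`): BSD₇ for every globally minimal model of
`49a1^{(−43)}` with `r_an = 1`**, by the prime-member class theorem at `(q, r) = (43, 19)` with the two
certificates above; the descent inputs (no `7`-torsion over `K`, `7 ∤ #Ш(W)`) are discharged inside the
class theorem (Mazur's local step; Buhler–Gross 1985 Ch. II BY NAME, binder `hBG`).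
[cite: KrizLi2019, Thm. 1.20 and Rem. 3.10] [cite: Rubin1983, §0 Thm. C (p. 341)]
[cite: BurungaleFlach2024, Thm 1.1 and Cor. 2] [cite: GrossZagier1986, I.(6.5) and V.(2.1)]
[cite: Miller2011LMS, Thm. 2.5 and (5.1)] [cite: BuhlerGross1985, Ch. II (7.2)(2), (8.3)(1), (9.1) (pp. 16–18)] -/
theorem bsdp_seven_of_twist_cm7_D43
    (hKL : KrizLi2019.thm120_padicLogHeegner_unit_of_bernoulli)
    (hRem : KrizLi2019.rem310_padicLogHeegner_integral)
    (W : WeierstrassCurve ℚ) [W.IsElliptic] [W.IsGloballyMinimal] [NeZero (W.conductorNorm ℤ)]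
    (hW : ∃ C : VariableChange ℚ, C • W = cm7.quadraticTwist ((-(43 : ℕ) : ℤ) : ℚ))
    (K : Type) [Field K] [NumberField K] [NeZero (NumberField.discr K).natAbs]
    (hK : IsImaginaryQuadratic K) (hdK : NumberField.discr K = -(19 : ℕ))
    (D : ModularParametrizationData W (W.conductorNorm ℤ))
    (H : HeegnerDatum (W.conductorNorm ℤ) (NumberField.discr K)) (ι : K →+* ℂ) (ιp : K →+* ℚ_[7])
    (P : (W.baseChange K).toAffine.Point)
    (hGZ : gross_zagier (W.conductorNorm ℤ) W K) (hKo : kolyvagin (W.conductorNorm ℤ) W K)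
    (hGZK : rank_eq_analyticRank_of_analyticRank_le_one) (hmod : hasEntireLFunction_rat)
    (hP : WeierstrassCurve.Affine.Point.map ι.toRatAlgHom P = heegnerPointComplex D H)
    (hr1 : W.analyticRank = 1)
    (hLt : (W.quadraticTwist (NumberField.discr K : ℚ)).entireLFunction 1 ≠ 0)
    (Wd : WeierstrassCurve ℚ) [Wd.IsElliptic] [Wd.IsGloballyMinimal] (Cd : VariableChange ℚ)
    (hWd : Cd • W.quadraticTwist (NumberField.discr K : ℚ) = Wd)
    (hBF : bsdTriple_of_hasCM_of_L_one_ne_zero)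
    (hu : padicValRat 7 (Cd.u : ℚ) = 0)
    (hC : Rubin1983.thmC_seven_quadraticField)
    (hBG : BuhlerGross1985.firstDescent_seven_oddTwist_of_bernoulli)
    [Finite (AddCommGroup.torsion (W.baseChange K).toAffine.Point)]
    (crd : (W.baseChange K).toAffine.Point →+ ℤ) (g : (W.baseChange K).toAffine.Point)
    (hg : crd g = 1) (hker : ∀ x, crd x = 0 → IsOfFinAddOrder x)
    (hc7 : ¬ ((7 : ℤ) ∣ D.c)) :
    BSDp W 7 :=
  bsdp_seven_of_twist_cm7_prime (q := 43) (r := 19) (by norm_num) (by norm_num) (by norm_num)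
    (by norm_num) (by norm_num) (by norm_num)
    (by rw [legendreSym_eq_ite 7 (by norm_num)]; decide)
    (by rw [legendreSym_eq_ite 43 (by norm_num)]; decide)
    (norm_generalizedBernoulli_theta1_D43) (norm_generalizedBernoulli_theta2_D43)
    hKL hRem W hW K hK hdK D H ι ιp P hGZ hKo hGZK hmod hP hr1 hLt Wd Cd hWd hBF hu hC hBG crd g hg
    hker hc7


/-- **ROUTE U, member `D = −43` (`90601c1`): FULL BSD** (Miller's `BSD(E,p)` at EVERY prime) for every
globally minimal model of `49a1^{(−43)}` with `r_an = 1` (`W ∈ 𝒞₇` since `(−7/43) = 1`), by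
`forall_bsdp_of_twist_cm7_prime` at `(q, r) = (43, 19)`.
[cite: Miller2011LMS, §1 and Def. 1.1 (arXiv:1010.2431 p. 3)] [cite: KrizLi2019, Thm. 1.20 and Rem. 3.10] -/
theorem forall_bsdp_of_twist_cm7_D43
    (hKL : KrizLi2019.thm120_padicLogHeegner_unit_of_bernoulli)
    (hRem : KrizLi2019.rem310_padicLogHeegner_integral)
    (W : WeierstrassCurve ℚ) [W.IsElliptic] [W.IsGloballyMinimal] [NeZero (W.conductorNorm ℤ)]
    (hW : ∃ C : VariableChange ℚ, C • W = cm7.quadraticTwist ((-(43 : ℕ) : ℤ) : ℚ))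
    (K : Type) [Field K] [NumberField K] [NeZero (NumberField.discr K).natAbs]
    (hK : IsImaginaryQuadratic K) (hdK : NumberField.discr K = -(19 : ℕ))
    (D : ModularParametrizationData W (W.conductorNorm ℤ))
    (H : HeegnerDatum (W.conductorNorm ℤ) (NumberField.discr K)) (ι : K →+* ℂ) (ιp : K →+* ℚ_[7])
    (P : (W.baseChange K).toAffine.Point)
    (hGZ : gross_zagier (W.conductorNorm ℤ) W K) (hKo : kolyvagin (W.conductorNorm ℤ) W K)
    (hGZK : rank_eq_analyticRank_of_analyticRank_le_one) (hmod : hasEntireLFunction_rat)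
    (hP : WeierstrassCurve.Affine.Point.map ι.toRatAlgHom P = heegnerPointComplex D H)
    (hr1 : W.analyticRank = 1)
    (hLt : (W.quadraticTwist (NumberField.discr K : ℚ)).entireLFunction 1 ≠ 0)
    (Wd : WeierstrassCurve ℚ) [Wd.IsElliptic] [Wd.IsGloballyMinimal] (Cd : VariableChange ℚ)
    (hWd : Cd • W.quadraticTwist (NumberField.discr K : ℚ) = Wd)
    (hBF : bsdTriple_of_hasCM_of_L_one_ne_zero)
    (hu : padicValRat 7 (Cd.u : ℚ) = 0)
    (hC : Rubin1983.thmC_seven_quadraticField)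
    (hBG : BuhlerGross1985.firstDescent_seven_oddTwist_of_bernoulli)
    [Finite (AddCommGroup.torsion (W.baseChange K).toAffine.Point)]
    (crd : (W.baseChange K).toAffine.Point →+ ℤ) (g : (W.baseChange K).toAffine.Point)
    (hg : crd g = 1) (hker : ∀ x, crd x = 0 → IsOfFinAddOrder x)
    (hc7 : ¬ ((7 : ℤ) ∣ D.c)) (hLLT : LiLiuTian2024.thm11_bsdp_of_cm_rank_one)
    (hKob : Kobayashi2013.cor14_bsdp_of_cm_rank_one) (hLTYZ : LiTianYanZhu2025.thm11_bsdp_of_cm_rank_one) :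
    ∀ p : ℕ, p.Prime → BSDp W p :=
  forall_bsdp_of_twist_cm7_prime (q := 43) (r := 19) (by norm_num) (by norm_num) (by norm_num)
    (by norm_num) (by norm_num) (by norm_num)
    (by rw [legendreSym_eq_ite 7 (by norm_num)]; decide)
    (by rw [legendreSym_eq_ite 43 (by norm_num)]; decide)
    (by rw [legendreSym_eq_ite 43 (by norm_num)]; decide)
    (norm_generalizedBernoulli_theta1_D43) (norm_generalizedBernoulli_theta2_D43)
    hKL hRem W hW K hK hdK D H ι ιp P hGZ hKo hGZK hmod hP hr1 hLt Wd Cd hWd hBF hu hC hBG crd g hg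
    hker hc7 hLLT hKob hLTYZ


end Summit.BirchSwinnertonDyer.Rank1Residual.X12.O11.RouteU

end
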